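import Summits.QuantumFields.BalabanUV.T4Continuum.Support.NE3CoarseInterpolant
import HarnessLib

/-!
# T⁴ programme, node NE3 — row E-MLw-(w4)-P, curved route H♮, row K5a (flat half of K5), file 1: THE TENT BUMP — fixing BLOCK MEANS
# at cost `M^{d−2}` without touching the block corners or faces

NE3 (node U1b) formalisation swarm `b2b-balaban-t4-ne3-formalise-*`, leaf seat `b2b-balaban-t4-ne3-formalise-leaf-01` (gen 5); row
**K5** of ruling ρ-g22-2 (`HOME/t4/b2b-balaban-t4-ne3-p1/g22/D-ne3p1-g22-1.md` §2 S7, §4 K5: «covariant block-mean-exact interpolant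
… + spikes», holder leaf-01-g5), flat half K5a (INTENT journal ≈16:57Z).  Sequel: `NE3BlockMeanExactInterpolant` (the multilinear
interpolant of H3 corrected by this bump to EXACT block means).

THE OBJECT.  On each block `M•z + [0,M)^d` the profile `tent M y = Π_i (ρ_i∕M)(1 − ρ_i∕M)` (`ρ = res M y`) vanishes on the corner and
on every face `{ρ_i = 0}`, has block sum `tentSum d M = ((M² − 1)∕(6M))^d`, and unit steps change it by at most `1∕M`.  The bump
`bump M c y := tent M y • c (blk M y)` therefore carries a coarse datum `c` into the fine lattice with
* `bump_of_res_eq_zero` (zero on corners∕faces), `sum_block_bump` (block sum `tentSum d M • c z`), `bump_add_period`;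
* **`norm_dPot_bump_le`** `‖dPot (bump M c) y α‖ ≤ (1∕M)·‖c (blk M y)‖` and
  **`sum_normSq_dPot_bump_le`** `Σ_{y∈periodBox (M·N)} Σ_α ‖dPot (bump M c) y α‖² ≤ d·(M^d∕M²)·Σ_{z∈periodBox N} ‖c z‖²`;
* `tentSum_eq`, **`tentSum_pos`**, `le_tentSum` (`(M∕8)^d ≤ tentSum d M` for `M ≥ 2`).
All [folklore]; 0 sorry; DATA defs `tent`, `tentSum`, `bump`.

HONEST FRAMING.  Pure lattice calculus; nothing about Bałaban's minimisers; (P♮), (ML_w) at W ≠ 1, T-E_w and **NE3 are NOT proved**;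
spine PROVED 0∕9; finite T⁴ rung (B)+1 — NOT infinite volume, NOT mass gap, NOT `BetaPertH`, NOT Clay.  PLACEMENT:
`Summits/QuantumFields/BalabanUV/`.  HONEST DEPENDENCY (cell page 1): continuum YM on T⁴ ⇐ BetaPertH ∧ nine spine estimates (0/9 proved);
BetaPertH ⇐ (D1) ∧ (D4) ∧ CAP+tail; G-an2-4 gates asym, D1 and NE2/3/4.
-/

set_option autoImplicit false

open scoped BigOperators
open Finset

namespace Summit.QuantumFields.BalabanUV.T4Continuum.NE3TentBump

open Literature.MathematicalPhysics.QuantumFieldTheory.Balaban1983to89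
open B7Prop1Explicit
open T4AveragingDeficitWallBoundary (periodBox mem_periodBox card_periodBox)
open SmoothRefineBlocks (blk res res_nonneg res_lt res_le blk_boxVec res_boxVec blk_res_smul blk_res_add_period blk_add_e
  res_add_e_self res_add_e_ne)
open SmoothRefineInterp (wt wt_nonneg wt_le_one)
open NE3BlockLineAverage (sum_univ_boxVec sum_periodBox_blocks)
open NE3TangentNoGoWords (dPot)
open NE3CoarseInterpolant (blk_block)

noncomputable section

variable {d : ℕ}

/-! ## §1 The one-dimensional profile `t(1 − t)` on the grid `t = ρ∕M` -/

/-- The profile factor of direction `i` at the fine site `y`: `(ρ_i∕M)(1 − ρ_i∕M)`. [folklore] -/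
def fac (M : ℕ) (y : Site d) (i : Fin d) : ℝ := wt M y i * (1 - wt M y i)

/-- `0 ≤ fac`. [folklore] -/
theorem fac_nonneg {M : ℕ} (hM : 1 ≤ M) (y : Site d) (i : Fin d) : 0 ≤ fac M y i :=
  mul_nonneg (wt_nonneg hM y i) (by linarith [wt_le_one hM y i])

/-- `fac ≤ 1`. [folklore] -/
theorem fac_le_one {M : ℕ} (hM : 1 ≤ M) (y : Site d) (i : Fin d) : fac M y i ≤ 1 := by
  have h0 := wt_nonneg hM y i
  have h1 := wt_le_one hM y i
  unfold fac; nlinarith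

/-- `wt` unfolded. [folklore] -/
theorem wt_eq (M : ℕ) (y : Site d) (i : Fin d) : wt M y i = (res M y i : ℝ) / M := rfl

/-- On the last slice `ρ_i = M − 1` the factor is at most `1∕M`. [folklore] -/
theorem fac_le_inv_of_res_eq {M : ℕ} (hM : 1 ≤ M) {y : Site d} {i : Fin d} (h : res M y i = (M : ℤ) - 1) :
    fac M y i ≤ 1 / (M : ℝ) := by
  have hM0 : (0 : ℝ) < M := by exact_mod_cast (by omega : 0 < M)
  have hw : wt M y i = 1 - 1 / (M : ℝ) := by
    rw [wt_eq, h]; push_cast; field_simp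
  unfold fac
  rw [hw]
  have : 0 ≤ 1 - 1 / (M : ℝ) := by
    rw [sub_nonneg, div_le_one hM0]; exact_mod_cast hM
  have h2 : (1 - 1 / (M : ℝ)) ≤ 1 := by linarith [one_div_pos.mpr hM0]
  calc (1 - 1 / (M : ℝ)) * (1 - (1 - 1 / (M : ℝ))) = (1 - 1 / (M : ℝ)) * (1 / M) := by ring
    _ ≤ 1 * (1 / M) := mul_le_mul_of_nonneg_right h2 (by positivity)
    _ = 1 / M := one_mul _

/-- On the first slice `ρ_i = 0` the factor vanishes. [folklore] -/
theorem fac_eq_zero_of_res_eq_zero {M : ℕ} {y : Site d} {i : Fin d} (h : res M y i = 0) : fac M y i = 0 := by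
  unfold fac; rw [wt_eq, h]; simp

/-- A unit step INSIDE the block changes the factor of its own direction by at most `1∕M`. [folklore] -/
theorem abs_fac_step_le {M : ℕ} (hM : 1 ≤ M) {y : Site d} {α : Fin d} (h : res M y α ≠ (M : ℤ) - 1) :
    |fac M (y + e α) α - fac M y α| ≤ 1 / (M : ℝ) := by
  have hM0 : (0 : ℝ) < M := by exact_mod_cast (by omega : 0 < M)
  have hres : res M (y + e α) α = res M y α + 1 := by rw [res_add_e_self hM, if_neg h]
  have hw' : wt M (y + e α) α = wt M y α + 1 / (M : ℝ) := by
    rw [wt_eq, wt_eq, hres]; push_cast; field_simp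
  set t := wt M y α with ht
  have ht0 : 0 ≤ t := wt_nonneg hM y α
  have ht1 : t ≤ 1 - 1 / (M : ℝ) := by
    have hle : res M y α ≤ (M : ℤ) - 1 := res_le hM y α
    have hlt : res M y α < (M : ℤ) - 1 := lt_of_le_of_ne hle h
    have hlt' : res M y α + 1 ≤ (M : ℤ) - 1 := by omega
    rw [ht, wt_eq, le_sub_iff_add_le, ← add_div, div_le_one hM0]
    have h' : ((res M y α + 1 : ℤ) : ℝ) ≤ (((M : ℤ) - 1 : ℤ) : ℝ) := by exact_mod_cast hlt'
    push_cast at h'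
    linarith
  unfold fac
  rw [hw']
  have hid : (t + 1 / (M : ℝ)) * (1 - (t + 1 / (M : ℝ))) - t * (1 - t) = (1 / (M : ℝ)) * (1 - 2 * t - 1 / M) := by ring
  rw [hid, abs_mul, abs_of_pos (one_div_pos.mpr hM0)]
  refine mul_le_of_le_one_right (by positivity) ?_
  rw [abs_le]
  have hinv : 0 < 1 / (M : ℝ) := one_div_pos.mpr hM0
  have hinv1 : 1 / (M : ℝ) ≤ 1 := by rw [div_le_one hM0]; exact_mod_cast hM
  constructor <;> nlinarith

/-! ## §2 The tent profile and its block sum -/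

/-- THE TENT PROFILE `tent M y = Π_i (ρ_i∕M)(1 − ρ_i∕M)`, `ρ = res M y`. [folklore] -/
def tent (M : ℕ) (y : Site d) : ℝ := ∏ i : Fin d, fac M y i

/-- `0 ≤ tent`. [folklore] -/
theorem tent_nonneg {M : ℕ} (hM : 1 ≤ M) (y : Site d) : 0 ≤ tent M y :=
  Finset.prod_nonneg fun i _ => fac_nonneg hM y i

/-- `tent ≤ 1`. [folklore] -/
theorem tent_le_one {M : ℕ} (hM : 1 ≤ M) (y : Site d) : tent M y ≤ 1 :=
  Finset.prod_le_one (fun i _ => fac_nonneg hM y i) fun i _ => fac_le_one hM y i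

/-- The tent vanishes where some offset coordinate vanishes (corners, faces). [folklore] -/
theorem tent_eq_zero_of_res_eq_zero {M : ℕ} {y : Site d} {i : Fin d} (h : res M y i = 0) : tent M y = 0 :=
  Finset.prod_eq_zero (Finset.mem_univ i) (fac_eq_zero_of_res_eq_zero h)

/-- On a last slice `ρ_α = M − 1` the tent is at most `1∕M`. [folklore] -/
theorem tent_le_inv_of_res_eq {M : ℕ} (hM : 1 ≤ M) {y : Site d} {α : Fin d} (h : res M y α = (M : ℤ) - 1) :
    tent M y ≤ 1 / (M : ℝ) := by
  unfold tent
  rw [← Finset.mul_prod_erase _ _ (Finset.mem_univ α)]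
  calc fac M y α * ∏ i ∈ Finset.univ.erase α, fac M y i ≤ (1 / (M : ℝ)) * 1 :=
        mul_le_mul (fac_le_inv_of_res_eq hM h)
          (Finset.prod_le_one (fun i _ => fac_nonneg hM y i) fun i _ => fac_le_one hM y i)
          (Finset.prod_nonneg fun i _ => fac_nonneg hM y i) (by positivity)
    _ = 1 / M := mul_one _

/-- A unit step INSIDE a block changes the tent by at most `1∕M`. [folklore] -/
theorem abs_tent_step_le {M : ℕ} (hM : 1 ≤ M) {y : Site d} {α : Fin d} (h : res M y α ≠ (M : ℤ) - 1) :
    |tent M (y + e α) - tent M y| ≤ 1 / (M : ℝ) := by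
  have hother : ∀ i ∈ Finset.univ.erase α, fac M (y + e α) i = fac M y i := by
    intro i hi
    have hne : i ≠ α := Finset.ne_of_mem_erase hi
    unfold fac; rw [wt_eq, wt_eq, res_add_e_ne hM y hne]
  unfold tent
  rw [← Finset.mul_prod_erase _ _ (Finset.mem_univ α), ← Finset.mul_prod_erase Finset.univ (fac M y) (Finset.mem_univ α),
    Finset.prod_congr rfl hother, ← sub_mul, abs_mul]
  have hP0 : 0 ≤ ∏ i ∈ Finset.univ.erase α, fac M y i := Finset.prod_nonneg fun i _ => fac_nonneg hM y i
  have hP1 : ∏ i ∈ Finset.univ.erase α, fac M y i ≤ 1 :=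
    Finset.prod_le_one (fun i _ => fac_nonneg hM y i) fun i _ => fac_le_one hM y i
  rw [abs_of_nonneg hP0]
  calc |fac M (y + e α) α - fac M y α| * ∏ i ∈ Finset.univ.erase α, fac M y i ≤ (1 / (M : ℝ)) * 1 :=
        mul_le_mul (abs_fac_step_le hM h) hP1 hP0 (by positivity)
    _ = 1 / M := mul_one _

/-- THE BLOCK SUM OF THE TENT: `tentSum d M = (Σ_{t<M} (t∕M)(1 − t∕M))^d`. [folklore] -/
def tentSum (d M : ℕ) : ℝ := (∑ t : Fin M, ((t : ℕ) : ℝ) / M * (1 - ((t : ℕ) : ℝ) / M)) ^ d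

/-- On the block `M•z + [0,M)^d` the tent sums to `tentSum d M`. [folklore] -/
theorem sum_block_tent {M : ℕ} (hM : 1 ≤ M) (z : Site d) :
    ∑ v ∈ periodBox (d := d) M, tent M ((M : ℤ) • z + v) = tentSum d M := by
  rw [← sum_univ_boxVec M (fun v => tent M ((M : ℤ) • z + v))]
  have hterm : ∀ r : Fin d → Fin M, tent M ((M : ℤ) • z + boxVec M r)
      = ∏ i : Fin d, (((r i : ℕ) : ℝ) / M * (1 - ((r i : ℕ) : ℝ) / M)) := by
    intro r
    unfold tent fac
    refine Finset.prod_congr rfl fun i _ => ?_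
    rw [wt_eq, res_boxVec hM z r]
    simp [boxVec]
  rw [Finset.sum_congr rfl fun r _ => hterm r, tentSum, ← Fintype.piFinset_univ,
    ← Finset.prod_univ_sum (fun _ : Fin d => (Finset.univ : Finset (Fin M)))
      (fun _ (t : Fin M) => ((t : ℕ) : ℝ) / M * (1 - ((t : ℕ) : ℝ) / M)),
    Finset.prod_const, Finset.card_univ, Fintype.card_fin]

/-- The two power sums behind the closed form: `Σ_{t<M} t = M(M−1)∕2` and `Σ_{t<M} t(M − t) = (M³ − M)∕6`. [folklore] -/
theorem sum_range_mul_sub (M : ℕ) :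
    (∑ t ∈ Finset.range M, (t : ℝ)) = (M : ℝ) * ((M : ℝ) - 1) / 2 ∧
      (∑ t ∈ Finset.range M, (t : ℝ) * ((M : ℝ) - t)) = ((M : ℝ) ^ 3 - M) / 6 := by
  induction M with
  | zero => simp
  | succ M ih =>
    obtain ⟨h1, h2⟩ := ih
    refine ⟨?_, ?_⟩
    · rw [Finset.sum_range_succ, h1]; push_cast; ring
    · have hsplit : ∑ t ∈ Finset.range (M + 1), (t : ℝ) * (((M + 1 : ℕ) : ℝ) - t)
          = ∑ t ∈ Finset.range M, ((t : ℝ) * ((M : ℝ) - t) + (t : ℝ)) + (M : ℝ) * (((M + 1 : ℕ) : ℝ) - M) := by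
        rw [Finset.sum_range_succ]
        congr 1
        refine Finset.sum_congr rfl fun t _ => ?_
        push_cast; ring
      rw [hsplit, Finset.sum_add_distrib, h1, h2]; push_cast; ring

/-- **`tentSum d M = ((M² − 1)∕(6M))^d`** (`M ≥ 1`). [folklore] -/
theorem tentSum_eq {M : ℕ} (hM : 1 ≤ M) (d : ℕ) : tentSum d M = ((((M : ℝ)) ^ 2 - 1) / (6 * M)) ^ d := by
  have hM0 : (M : ℝ) ≠ 0 := by exact_mod_cast (by omega : M ≠ 0)
  unfold tentSum
  congr 1
  have h := (sum_range_mul_sub M).2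
  rw [Fin.sum_univ_eq_sum_range (fun t => (t : ℝ) / M * (1 - (t : ℝ) / M)) M]
  have hterm : ∀ t ∈ Finset.range M, (t : ℝ) / M * (1 - (t : ℝ) / M) = (1 / (M : ℝ) ^ 2) * ((t : ℝ) * ((M : ℝ) - t)) := by
    intro t _; field_simp
  rw [Finset.sum_congr rfl hterm, ← Finset.mul_sum, h]
  field_simp

/-- **`(M∕8)^d ≤ tentSum d M`** for `M ≥ 2`. [folklore] -/
theorem le_tentSum {M : ℕ} (hM : 2 ≤ M) (d : ℕ) : ((M : ℝ) / 8) ^ d ≤ tentSum d M := by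
  rw [tentSum_eq (by omega) d]
  have hM2 : (2 : ℝ) ≤ M := by exact_mod_cast hM
  have hM0 : (0 : ℝ) < M := by linarith
  refine pow_le_pow_left₀ (by positivity) ?_ d
  rw [div_le_div_iff₀ (by norm_num) (by positivity)]
  nlinarith

/-- **`0 < tentSum d M`** for `M ≥ 2`. [folklore] -/
theorem tentSum_pos {M : ℕ} (hM : 2 ≤ M) (d : ℕ) : 0 < tentSum d M := by
  have hM0 : (0 : ℝ) < M := by exact_mod_cast (by omega : 0 < M)
  exact lt_of_lt_of_le (by positivity) (le_tentSum hM d)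

/-! ## §3 The bump: block means at cost `M^{d−2}`, corners and faces untouched -/

section Bump

variable {𝔸 : Type*} [NormedRing 𝔸] [NormedSpace ℝ 𝔸]

/-- THE TENT BUMP carrying the coarse datum `c`: `bump M c y = tent M y • c (blk M y)`. [folklore] -/
def bump (M : ℕ) (c : Site d → 𝔸) (y : Site d) : 𝔸 := tent M y • c (blk M y)

/-- The bump vanishes where some offset coordinate vanishes — in particular at the block corners and on entering faces. [folklore] -/
theorem bump_of_res_eq_zero (M : ℕ) (c : Site d → 𝔸) {y : Site d} {i : Fin d} (h : res M y i = 0) : bump M c y = 0 := by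
  unfold bump; rw [tent_eq_zero_of_res_eq_zero h, zero_smul]

/-- The bump vanishes at the block corners (`d ≥ 1`). [folklore] -/
theorem bump_corner {M : ℕ} (hM : 1 ≤ M) (hd : 0 < d) (c : Site d → 𝔸) (z : Site d) : bump M c ((M : ℤ) • z) = 0 :=
  bump_of_res_eq_zero M c (i := ⟨0, hd⟩) (by rw [(blk_res_smul hM z).2]; rfl)

/-- **THE BLOCK SUM OF THE BUMP**: `Σ_{v∈[0,M)^d} bump M c (M•z + v) = tentSum d M • c z`. [folklore] -/
theorem sum_block_bump {M : ℕ} (hM : 1 ≤ M) (c : Site d → 𝔸) (z : Site d) :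
    ∑ v ∈ periodBox (d := d) M, bump M c ((M : ℤ) • z + v) = tentSum d M • c z := by
  unfold bump
  rw [Finset.sum_congr rfl fun v hv => by rw [blk_block hM z hv], ← Finset.sum_smul, sum_block_tent hM z]

/-- Periodicity: an `N`-periodic datum gives an `(M·N)`-periodic bump. [folklore] -/
theorem bump_add_period {M : ℕ} (hM : 1 ≤ M) {N : ℕ} {c : Site d → 𝔸}
    (hc : ∀ (z : Site d) (τ : Fin d), c (z + (N : ℤ) • e τ) = c z) (y : Site d) (τ : Fin d) :
    bump M c (y + ((M * N : ℕ) : ℤ) • e τ) = bump M c y := by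
  obtain ⟨hb, hr⟩ := blk_res_add_period (d := d) hM y (N : ℤ) τ
  have hP : ((M * N : ℕ) : ℤ) = (M : ℤ) * (N : ℤ) := by push_cast; ring
  have ht : tent M (y + ((M : ℤ) * (N : ℤ)) • e τ) = tent M y := by
    unfold tent fac; simp only [wt_eq, hr]
  unfold bump
  rw [hP, ht, hb, hc]

/-- **THE COBOUNDARY OF THE BUMP IS `O(1∕M)` TIMES THE LOCAL DATUM**: `‖dPot (bump M c) y α‖ ≤ (1∕M)·‖c (blk M y)‖`
(inside a block the tent moves by ≤ `1∕M`; across a face the arriving tent is `0` and the departing one ≤ `1∕M`). [folklore] -/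
theorem norm_dPot_bump_le {M : ℕ} (hM : 1 ≤ M) (c : Site d → 𝔸) (y : Site d) (α : Fin d) :
    ‖dPot (bump M c) y α‖ ≤ (1 / (M : ℝ)) * ‖c (blk M y)‖ := by
  simp only [dPot, bump]
  by_cases h : res M y α = (M : ℤ) - 1
  · -- crossing a block face: the arriving site has `ρ_α = 0`
    have hres' : res M (y + e α) α = 0 := by rw [res_add_e_self hM, if_pos h]
    rw [tent_eq_zero_of_res_eq_zero hres', zero_smul, zero_sub, norm_neg, norm_smul,
      Real.norm_of_nonneg (tent_nonneg hM y)]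
    exact mul_le_mul_of_nonneg_right (tent_le_inv_of_res_eq hM h) (norm_nonneg _)
  · -- inside the block: same block, the tent moves by ≤ 1∕M
    have hblk : blk M (y + e α) = blk M y := by rw [blk_add_e hM, if_neg h, add_zero]
    rw [hblk, ← sub_smul, norm_smul, Real.norm_eq_abs]
    exact mul_le_mul_of_nonneg_right (abs_tent_step_le hM h) (norm_nonneg _)

/-- **THE DIRICHLET ENERGY OF THE BUMP** over the torus of side `M·N`:
`Σ_{y∈periodBox (M·N)} Σ_α ‖dPot (bump M c) y α‖² ≤ d·(M^d∕M²)·Σ_{z∈periodBox N} ‖c z‖²` (`M ≥ 1`). [folklore] -/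
theorem sum_normSq_dPot_bump_le {M : ℕ} (hM : 1 ≤ M) (N : ℕ) (c : Site d → 𝔸) :
    ∑ y ∈ periodBox (d := d) (M * N), ∑ α : Fin d, ‖dPot (bump M c) y α‖ ^ 2
      ≤ (d : ℝ) * ((M : ℝ) ^ d / (M : ℝ) ^ 2) * ∑ z ∈ periodBox (d := d) N, ‖c z‖ ^ 2 := by
  have hM0 : (0 : ℝ) < M := by exact_mod_cast (by omega : 0 < M)
  have hpt : ∀ (y : Site d) (α : Fin d), ‖dPot (bump M c) y α‖ ^ 2 ≤ (1 / (M : ℝ) ^ 2) * ‖c (blk M y)‖ ^ 2 := by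
    intro y α
    have h := norm_dPot_bump_le hM c y α
    calc ‖dPot (bump M c) y α‖ ^ 2 ≤ ((1 / (M : ℝ)) * ‖c (blk M y)‖) ^ 2 := pow_le_pow_left₀ (norm_nonneg _) h 2
      _ = (1 / (M : ℝ) ^ 2) * ‖c (blk M y)‖ ^ 2 := by ring
  calc ∑ y ∈ periodBox (d := d) (M * N), ∑ α : Fin d, ‖dPot (bump M c) y α‖ ^ 2
      ≤ ∑ y ∈ periodBox (d := d) (M * N), ∑ _α : Fin d, (1 / (M : ℝ) ^ 2) * ‖c (blk M y)‖ ^ 2 :=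
        Finset.sum_le_sum fun y _ => Finset.sum_le_sum fun α _ => hpt y α
    _ = ∑ z ∈ periodBox (d := d) N, ∑ v ∈ periodBox (d := d) M, (d : ℝ) * ((1 / (M : ℝ) ^ 2) * ‖c z‖ ^ 2) := by
        rw [← sum_periodBox_blocks M N hM]
        refine Finset.sum_congr rfl fun z _ => Finset.sum_congr rfl fun v hv => ?_
        rw [blk_block hM z hv, Finset.sum_const, Finset.card_univ, Fintype.card_fin, nsmul_eq_mul]
    _ = (d : ℝ) * ((M : ℝ) ^ d / (M : ℝ) ^ 2) * ∑ z ∈ periodBox (d := d) N, ‖c z‖ ^ 2 := by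
        rw [Finset.mul_sum]
        refine Finset.sum_congr rfl fun z _ => ?_
        rw [Finset.sum_const, card_periodBox, nsmul_eq_mul]
        push_cast
        field_simp

end Bump

end

end Summit.QuantumFields.BalabanUV.T4Continuum.NE3TentBump
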